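import Summits.BirchSwinnertonDyer.BirchSwinnertonDyer.Theses.ShaPrimaryTransfer
import Literature.NumberTheory.EllipticCurves.TwoIsogenyShaTwoTorsionExamples
import Literature.NumberTheory.EllipticCurves.Curve8x121ShaTwoTorsion
import Literature.NumberTheory.EllipticCurves.Curve388ShaTwoTorsion
import HarnessLib

/-!
# Route ShaPrimaryTransfer — the ISOGENY-DOOR TABLE: two curves with `t_2 = 0` certified through the isogeny class
# while `Ш[2] ≅ (ℤ/2ℤ)²` (ranks `0` and `2`)

Helper for item stmt-BirchSwinnertonDyer-22356 (`FiniteShaComponentTransfer`, «T»; conjecture-grade at rank `≥ 2`,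
unchanged) of route `route-BirchSwinnertonDyer-ShaPrimaryTransfer`. BSD is NOT proved by any of this; T is not proved by
any of this; no beyond-print theorem (Silverman, *AEC* X.4.9 / X.6.5 on routine curves).

The table (Literature files `XCubeSub8XSqAddX*`, `Curve346*`, `TwoIsogenyShaTwoTorsion{EqPhi,Examples}`, this seat):

| carrier `X` | rank | `t_2(X)` | `#Ш(X/ℚ)[2]` | isogenous sharp model `Y` (`Ш(Y)[2] = 0`) |
|---|---|---|---|---|
| `X₈ = [0, −8, 0, 1, 0]` : `y² = x³ − 8x² + x` | `0` | `0` | `4` | `[0, −2, 0, −24, 0] = x(x − 6)(x + 4)` |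
| `X₃₄₆ = [0, −346, 0, 1369, 0]` | `2` | `0` | `4` | `[0, −31, 0, −2516, 0] = x(x + 37)(x − 68)` |

* `isogenyDoorTable_two_rows` — both rows by name: rank, `t_2 = 0`, `#Ш[2] = 4` (so `Ш[2^∞]` is finite AND non-zero), and
  the sharp isogenous model;
* `isogenyDoorTable_transfer` — granting T, `t_q = 0` at EVERY prime on both carriers (T's predictions; unconditional at `q = 2`);
* `isogenyDoorTable_selmerCorank_of_transfer` — the same in Selmer coordinates: `corank_{ℤ_q} Sel_{q^∞} = rank` at every `q`.

What the table says about T: its HYPOTHESIS `t_p(E) = 0` is a corank statement that complete `p`-descent on `E` may fail to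
show even when true (both rows), but which ONE sharp descent anywhere in the isogeny class settles (g3 §2); its CONCLUSION at
a second prime is untouched here (no `3`-structure on these carriers). The verdict on T is unchanged.
-/

-- D-0017: single-problem summit, so `Summit.BirchSwinnertonDyer.BirchSwinnertonDyer.…` repeats a namespace BY DESIGN.
set_option linter.dupNamespace false

noncomputable section

namespace Summit.BirchSwinnertonDyer.BirchSwinnertonDyer.Theorems.ShaPrimaryTransferIsogenyDoorTable

open scoped Classical
open Summit.BirchSwinnertonDyer.BirchSwinnertonDyer.Theses.ShaPrimaryTransfer (FiniteShaComponentTransfer)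
open Literature.NumberTheory.EllipticCurves
open WeierstrassCurve

/-- **The isogeny-door table, both rows.** Row 1: `X₈ = [0,−8,0,1,0]` has rank `0`, `t_2 = 0`, `#Ш(X₈/ℚ)[2] = 4`, and is
isogenous to `Y₈ = [0,−2,0,−24,0]` with `Ш(Y₈/ℚ)[2] = 0`. Row 2: `X₃₄₆ = [0,−346,0,1369,0]` has rank `2`, `t_2 = 0`,
`#Ш(X₃₄₆/ℚ)[2] = 4`, and is isogenous to `Y₃₄₆ = [0,−31,0,−2516,0]` with `Ш(Y₃₄₆/ℚ)[2] = 0`. All unconditional. -/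
theorem isogenyDoorTable_two_rows
    [(⟨0, -8, 0, 1, 0⟩ : WeierstrassCurve ℚ).IsElliptic] [(⟨0, -346, 0, 1369, 0⟩ : WeierstrassCurve ℚ).IsElliptic] :
    ((⟨0, -8, 0, 1, 0⟩ : WeierstrassCurve ℚ).mordellWeilRank = 0 ∧
      (⟨0, -8, 0, 1, 0⟩ : WeierstrassCurve ℚ).shaCorank 2 = 0 ∧
      Nat.card ↥((⟨0, -8, 0, 1, 0⟩ : WeierstrassCurve ℚ).sha ⊓
        AddSubgroup.torsionBy (⟨0, -8, 0, 1, 0⟩ : WeierstrassCurve ℚ).galH1 2) = 4 ∧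
      IsIsogenous (⟨0, -8, 0, 1, 0⟩ : WeierstrassCurve ℚ) (⟨0, -2, 0, -24, 0⟩ : WeierstrassCurve ℚ) ∧
      (∀ c ∈ (⟨0, -2, 0, -24, 0⟩ : WeierstrassCurve ℚ).sha, 2 • c = 0 → c = 0)) ∧
    ((⟨0, -346, 0, 1369, 0⟩ : WeierstrassCurve ℚ).mordellWeilRank = 2 ∧
      (⟨0, -346, 0, 1369, 0⟩ : WeierstrassCurve ℚ).shaCorank 2 = 0 ∧
      Nat.card ↥((⟨0, -346, 0, 1369, 0⟩ : WeierstrassCurve ℚ).sha ⊓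
        AddSubgroup.torsionBy (⟨0, -346, 0, 1369, 0⟩ : WeierstrassCurve ℚ).galH1 2) = 4 ∧
      IsIsogenous (⟨0, -346, 0, 1369, 0⟩ : WeierstrassCurve ℚ) (⟨0, -31, 0, -2516, 0⟩ : WeierstrassCurve ℚ) ∧
      (∀ c ∈ (⟨0, -31, 0, -2516, 0⟩ : WeierstrassCurve ℚ).sha, 2 • c = 0 → c = 0)) :=
  ⟨⟨XCubeSub8XSqAddX.mordellWeilRank_X, XCubeSub8XSqAddX.shaCorank_X_two,
      ShaTwoTorsionExamples.natCard_sha_inf_torsionBy_two_X8, XCubeSub8XSqAddX.isIsogenous_X_Y,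
      XCubeSub8XSqAddX.forall_mem_sha_Y_two_smul_eq_zero⟩,
    ⟨Curve346.mordellWeilRank_X, Curve346.shaCorank_X_two, ShaTwoTorsionExamples.natCard_sha_inf_torsionBy_two_X346,
      Curve346.isIsogenous_X_Y, Curve346.forall_mem_sha_Y_two_smul_eq_zero⟩⟩

/-- **T on the table**: granting T, `t_q = 0` at every prime `q` on both carriers (from the unconditional `t_2 = 0`).
CONDITIONAL on `hT`. -/
theorem isogenyDoorTable_transfer (hT : FiniteShaComponentTransfer) (q : ℕ) [Fact q.Prime] :
    (⟨0, -8, 0, 1, 0⟩ : WeierstrassCurve ℚ).shaCorank q = 0 ∧ (⟨0, -346, 0, 1369, 0⟩ : WeierstrassCurve ℚ).shaCorank q = 0 := by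
  haveI := XCubeSub8XSqAddX.isElliptic_X
  haveI := Curve346.isElliptic_X
  haveI : Fact (Nat.Prime 2) := ⟨Nat.prime_two⟩
  exact ⟨hT _ 2 q XCubeSub8XSqAddX.shaCorank_X_two, hT _ 2 q Curve346.shaCorank_X_two⟩

/-- **T on the table, Selmer coordinates**: granting T, `corank_{ℤ_q} Sel_{q^∞}(X₈) = 0` and `corank_{ℤ_q} Sel_{q^∞}(X₃₄₆) = 2`
at every prime `q` (Greenberg's identity, tree theorem `selmerCorank_eq_mordellWeilRank_add_holds`). CONDITIONAL on `hT`. -/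
theorem isogenyDoorTable_selmerCorank_of_transfer (hT : FiniteShaComponentTransfer) (q : ℕ) [Fact q.Prime] :
    (⟨0, -8, 0, 1, 0⟩ : WeierstrassCurve ℚ).selmerCorank q = 0 ∧ (⟨0, -346, 0, 1369, 0⟩ : WeierstrassCurve ℚ).selmerCorank q = 2 := by
  haveI := XCubeSub8XSqAddX.isElliptic_X
  haveI := Curve346.isElliptic_X
  obtain ⟨h8, h346⟩ := isogenyDoorTable_transfer hT q
  refine ⟨?_, ?_⟩
  · rw [WeierstrassCurve.selmerCorank_eq_mordellWeilRank_add_holds, XCubeSub8XSqAddX.mordellWeilRank_X, h8]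
  · rw [WeierstrassCurve.selmerCorank_eq_mordellWeilRank_add_holds, Curve346.mordellWeilRank_X, h346]

/-! ## Row 3 (appended): the rank-`1` carrier `X₁₂₁ = [0, 8, 0, 121, 0]` -/

/-- **The isogeny-door table with THREE rows, one at each of the ranks `0, 1, 2`.** Row of rank `1` (appended):
`X₁₂₁ = [0, 8, 0, 121, 0]` (from `E₀ = x(x − 14)(x − 44)`, `X₁₂₁' = [0, −16, 0, −420, 0] ≅ E₀`) has rank `1`, `t_2 = 0`,
`#Ш(X₁₂₁/ℚ)[2] = 4` (all `32` classes of `S(−16, −420)` everywhere locally soluble, `8` from `X'(ℚ)`; dual side trivial), and is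
isogenous to `Y = [0, −58, 0, 616, 0] = x(x − 14)(x − 44)` with `Ш(Y/ℚ)[2] = 0` (Literature `Curve8x121*`, `Curve8x121.rankOne_row`);
rows of rank `0` and `2` as in `isogenyDoorTable_two_rows`. -/
theorem isogenyDoorTable_three_rows
    [(⟨0, -8, 0, 1, 0⟩ : WeierstrassCurve ℚ).IsElliptic] [(⟨0, 8, 0, 121, 0⟩ : WeierstrassCurve ℚ).IsElliptic]
    [(⟨0, -346, 0, 1369, 0⟩ : WeierstrassCurve ℚ).IsElliptic] :
    ((⟨0, -8, 0, 1, 0⟩ : WeierstrassCurve ℚ).mordellWeilRank = 0 ∧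
      (⟨0, -8, 0, 1, 0⟩ : WeierstrassCurve ℚ).shaCorank 2 = 0 ∧
      Nat.card ↥((⟨0, -8, 0, 1, 0⟩ : WeierstrassCurve ℚ).sha ⊓
        AddSubgroup.torsionBy (⟨0, -8, 0, 1, 0⟩ : WeierstrassCurve ℚ).galH1 2) = 4) ∧
    ((⟨0, 8, 0, 121, 0⟩ : WeierstrassCurve ℚ).mordellWeilRank = 1 ∧
      (⟨0, 8, 0, 121, 0⟩ : WeierstrassCurve ℚ).shaCorank 2 = 0 ∧
      Nat.card ↥((⟨0, 8, 0, 121, 0⟩ : WeierstrassCurve ℚ).sha ⊓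
        AddSubgroup.torsionBy (⟨0, 8, 0, 121, 0⟩ : WeierstrassCurve ℚ).galH1 2) = 4) ∧
    ((⟨0, -346, 0, 1369, 0⟩ : WeierstrassCurve ℚ).mordellWeilRank = 2 ∧
      (⟨0, -346, 0, 1369, 0⟩ : WeierstrassCurve ℚ).shaCorank 2 = 0 ∧
      Nat.card ↥((⟨0, -346, 0, 1369, 0⟩ : WeierstrassCurve ℚ).sha ⊓
        AddSubgroup.torsionBy (⟨0, -346, 0, 1369, 0⟩ : WeierstrassCurve ℚ).galH1 2) = 4) := by
  obtain ⟨⟨h0r, h0t, h0s, -, -⟩, ⟨h2r, h2t, h2s, -, -⟩⟩ := isogenyDoorTable_two_rows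
  obtain ⟨h1r, h1t, h1s, -, -⟩ := Curve8x121.rankOne_row
  exact ⟨⟨h0r, h0t, h0s⟩, ⟨h1r, h1t, h1s⟩, ⟨h2r, h2t, h2s⟩⟩

/-- **T on the rank-`1` row**: granting T, `t_q(X₁₂₁) = 0` and `corank_{ℤ_q} Sel_{q^∞}(X₁₂₁/ℚ) = 1 = rank` at every prime `q`
(unconditional at `q = 2`). CONDITIONAL on `hT`. -/
theorem isogenyDoorTable_rankOne_transfer (hT : FiniteShaComponentTransfer) (q : ℕ) [Fact q.Prime] :
    (⟨0, 8, 0, 121, 0⟩ : WeierstrassCurve ℚ).shaCorank q = 0 ∧ (⟨0, 8, 0, 121, 0⟩ : WeierstrassCurve ℚ).selmerCorank q = 1 := by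
  haveI := Curve8x121.isElliptic_X
  haveI : Fact (Nat.Prime 2) := ⟨Nat.prime_two⟩
  have h := hT _ 2 q Curve8x121.shaCorank_X_two
  refine ⟨h, ?_⟩
  rw [WeierstrassCurve.selmerCorank_eq_mordellWeilRank_add_holds, Curve8x121.mordellWeilRank_X, h]

/-! ## Row 4 (appended): a second rank-`2` carrier `X₃₈₈ = [0, −388, 0, 676, 0]` -/

/-- **Fourth row (second rank-`2` row) and T on it.** `X₃₈₈ = [0, −388, 0, 676, 0]` (from `E₀ = x(x + 26)(x − 84)`,
`X₃₈₈' = [0, 776, 0, 147840, 0] ≅ E₀`): rank `2`, `t_2 = 0`, `#Ш(X₃₈₈/ℚ)[2] = 4` (all `64` classes of `S(776, 147840)` everywhere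
locally soluble, `16` from `X'(ℚ)`; dual side trivial), isogenous to the sharp `Y = [0, −58, 0, −2184, 0] = x(x + 26)(x − 84)`
(Literature `Curve388*`, `Curve388.rankTwo_row`); and, granting T, `t_q(X₃₈₈) = 0` with `corank_{ℤ_q} Sel_{q^∞}(X₃₈₈/ℚ) = 2` at every
prime `q`. The table now has TWO rank-`2` rows. The T-part is CONDITIONAL on `hT`; the row itself is unconditional. -/
theorem isogenyDoorTable_row_four (hT : FiniteShaComponentTransfer) (q : ℕ) [Fact q.Prime]
    [(⟨0, -388, 0, 676, 0⟩ : WeierstrassCurve ℚ).IsElliptic] :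
    ((⟨0, -388, 0, 676, 0⟩ : WeierstrassCurve ℚ).mordellWeilRank = 2 ∧
      (⟨0, -388, 0, 676, 0⟩ : WeierstrassCurve ℚ).shaCorank 2 = 0 ∧
      Nat.card ↥((⟨0, -388, 0, 676, 0⟩ : WeierstrassCurve ℚ).sha ⊓
        AddSubgroup.torsionBy (⟨0, -388, 0, 676, 0⟩ : WeierstrassCurve ℚ).galH1 2) = 4) ∧
    ((⟨0, -388, 0, 676, 0⟩ : WeierstrassCurve ℚ).shaCorank q = 0 ∧
      (⟨0, -388, 0, 676, 0⟩ : WeierstrassCurve ℚ).selmerCorank q = 2) := by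
  obtain ⟨hr, ht, hs, -, -⟩ := Curve388.rankTwo_row
  haveI : Fact (Nat.Prime 2) := ⟨Nat.prime_two⟩
  have hq := hT _ 2 q ht
  refine ⟨⟨hr, ht, hs⟩, hq, ?_⟩
  rw [WeierstrassCurve.selmerCorank_eq_mordellWeilRank_add_holds, hr, hq]

end Summit.BirchSwinnertonDyer.BirchSwinnertonDyer.Theorems.ShaPrimaryTransferIsogenyDoorTable

end
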